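import Summits.HodgeConjecture.HodgeConjecture.Theorems.K2E3LocalHermitianWittIndex
import Literature.NumberTheory.Automorphic.LocalUnitaryGroupCongr
import Literature.NumberTheory.Automorphic.UnitaryGroupNonsplitPlace
import Literature.NumberTheory.Weil1982.UnitaryLocalRingBaseField
import Mathlib.Data.Matrix.PEquiv
import HarnessLib

/-!
# K2 ∕ E3 «EllipticInputs», 13a road A, J4 (i) consequence: in ODD rank `N` all unitary groups `U_N(H)` over a CM field are
# LOCALLY ISOMORPHIC at every finite place — in particular to the quasi-split `U(Φ_N)` (`Φ_N = antidiag(1,…,1)`)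

Cell `hodgecm-mathlib` (Track B «K2-LIT»), item h413 = `stmt-HodgeConjecture-24833`; author K2E3-p10 (g2); count-neutral structure helper for the
13a line (road A: every `★ Φ_N` structure file — Borel ∕ Iwasawa `exists_borel_mul_mem_cmLocalIntegralLevel`, `AnyRank` ray lemmas, hyperspecial
Cartan — becomes available for `U_N(H)(L⁺_v)` with `N` odd) and for the quasi-split comparison `G′_v ≅ G_v` of [Rogawski1990, §14.2] in every odd
rank (the tree had it in rank `3`: ★ `nonempty_cmDatum_local_equiv_qsForm_forall`).  PROOF lane: theorems only (no `def`, no `instance`, no `sorry`).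

Mechanism: at a non-split `v` (`E_v = L ⊗ L⁺_v` a field) ★ `exists_GL_formCongr_eq_wittMatrix_rev_le_two` (K2E3-p10 (g2)) writes `H_v` AND `H'_v` as
`W♭(r, (a))`, `W♭(r, (a'))` with the SAME `r = (N−1)∕2` (odd `N` forces the anisotropic kernel to have rank `m = 1`); scaling the `f`-block turns
`W♭(r, (a))` into `a • W♭(r, (1))` (§2), a permutation matrix matches the two index bijections (§1), and ★ `cmDatumLocalCongr` transports the
resulting local similitude `ᵗ(σX)·H'_v·X = (a'a⁻¹) • H_v` to `U(H)(L⁺_v) ≃ₜ* U(H')(L⁺_v)`; the split places are ★ `cmDatumLocalSplitCongr`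
(`nonempty_cmDatum_local_equiv_of_forall_nonsplit`).

* §1 `formCongr_mul`; `exists_GL_formCongr_reindex_eq_reindex` — permutation matrices re-index: `∃ P ∈ GL_n`, `ᵗ(σP)·(reindex e' e' M)·P = reindex e e M`.
* §2 `exists_GL_formCongr_wittMatrix_one_eq_smul` — for `m = 1`: `∃ D ∈ GL_n`, `ᵗ(σD)·(reindex e e W♭(r,(a)))·D = a • reindex e e W♭(r,(1))` (`σ a = a`).
* §3 **`nonempty_cmDatum_local_equiv_of_odd_of_smul_eq`** (non-split `v`), **`nonempty_cmDatum_local_equiv_of_odd`** (every finite `v`): for `N` odd and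
  `H, H'` hermitian with unit determinant, `Nonempty ((cmDatum L N H).Local v ≃ₜ* (cmDatum L N H').Local v)`;
  **`nonempty_cmDatum_local_equiv_antidiag_of_odd`**: `U_N(H)(L⁺_v) ≃ₜ* U(Φ_N)(L⁺_v)` for every odd `N`, every `H`, every finite `v`.

References: R. Jacobowitz, *Hermitian forms over local fields*, Amer. J. Math. 84 (1962), Thm. 3.1 (local hermitian forms are classified by rank and
discriminant; odd rank ⇒ the unitary group is quasi-split); J. Rogawski, *Automorphic Representations of Unitary Groups in Three Variables* (1990), §14.2;
V. Platonov, A. Rapinchuk, *Algebraic Groups and Number Theory* (1994), §2.3.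
-/

set_option autoImplicit false
set_option linter.dupNamespace false

noncomputable section

namespace Summit.HodgeConjecture.HodgeConjecture.Cruxes.H413.K2E3OddUnitaryLocalCongr

open NumberField IsDedekindDomain
open Literature.NumberTheory.Automorphic Literature.NumberTheory.Automorphic.UnitaryGroup
open K2E3LocalHermitianWittIndex
open scoped Matrix MatrixGroups

/-! ## §1 Permutation matrices re-index; scaling the `f`-block -/

section Generic

variable {R : Type*} [CommRing R] (σ : R →+* R) {n : Type*} [Fintype n] [DecidableEq n] {ι : Type*} [Fintype ι] [DecidableEq ι]

omit [Fintype n] [DecidableEq n] [Fintype ι] [DecidableEq ι] in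
/-- `formCongr` is multiplicative in the change of basis: `ᵗσ(AB)·J·(AB) = ᵗσB·(ᵗσA·J·A)·B`. [folklore] -/
theorem formCongr_mul [Fintype n] [DecidableEq n] (A B : GL n R) (J : Matrix n n R) :
    formCongr σ (A * B) J = formCongr σ B (formCongr σ A J) := by
  simp only [formCongr, Units.val_mul, Matrix.map_mul, Matrix.transpose_mul, Matrix.mul_assoc]

omit [Fintype ι] [DecidableEq ι] in
/-- **Permutation matrices re-index**: for two bijections `e e' : ι ≃ n` there is `P ∈ GL_n(R)` (the permutation matrix of `e ∘ e'⁻¹`, with `σ`-fixed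
`0∕1` entries) with `ᵗ(σP) · reindex e' e' M · P = reindex e e M`. [folklore] -/
theorem exists_GL_formCongr_reindex_eq_reindex (e e' : ι ≃ n) (M : Matrix ι ι R) :
    ∃ P : GL n R, formCongr σ P (Matrix.reindex e' e' M) = Matrix.reindex e e M := by
  classical
  let π : n ≃ n := e'.symm.trans e
  -- the permutation matrix of `π` and its inverse
  have hmul : (π.toPEquiv.toMatrix : Matrix n n R) * π.symm.toPEquiv.toMatrix = 1 := by
    rw [← PEquiv.toMatrix_trans, ← Equiv.toPEquiv_trans, Equiv.self_trans_symm, Equiv.toPEquiv_refl, PEquiv.toMatrix_refl]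
  have hmul' : (π.symm.toPEquiv.toMatrix : Matrix n n R) * π.toPEquiv.toMatrix = 1 := by
    rw [← PEquiv.toMatrix_trans, ← Equiv.toPEquiv_trans, Equiv.symm_trans_self, Equiv.toPEquiv_refl, PEquiv.toMatrix_refl]
  let P : GL n R := ⟨π.toPEquiv.toMatrix, π.symm.toPEquiv.toMatrix, hmul, hmul'⟩
  refine ⟨P, ?_⟩
  have hP : (P : Matrix n n R) = π.toPEquiv.toMatrix := rfl
  have hmap : (π.toPEquiv.toMatrix : Matrix n n R).map σ = π.toPEquiv.toMatrix := by
    ext i j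
    simp only [Matrix.map_apply, PEquiv.toMatrix_apply]
    split_ifs
    · exact map_one σ
    · exact map_zero σ
  have htr : (π.toPEquiv.toMatrix : Matrix n n R)ᵀ = π.symm.toPEquiv.toMatrix := by
    rw [Equiv.toPEquiv_symm, PEquiv.toMatrix_symm]
  simp only [formCongr, hP, hmap, htr]
  rw [PEquiv.toMatrix_toPEquiv_mul, PEquiv.mul_toMatrix_toPEquiv]
  ext i j
  simp only [Matrix.reindex_apply, Matrix.submatrix_apply, id, π, Equiv.symm_trans_apply, Equiv.symm_symm,
    Equiv.symm_apply_apply]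

/-- **Scaling the `f`-block** (`m = 1`): for `a` with `σ a = a` a unit, the diagonal change of basis `D = diag(1 on e ∣ 1 ∣ a on f)` (read through
`e`) turns `W♭(r, (a))` into `a • W♭(r, (1))`. [folklore] -/
theorem exists_GL_formCongr_wittMatrix_one_eq_smul {r : ℕ} (e : Fin r ⊕ (Fin 1 ⊕ Fin r) ≃ n) (a : R) (hσa : σ a = a) (ha : IsUnit a)
    (Han : Matrix (Fin 1) (Fin 1) R) (hHan : Han 0 0 = a) :
    ∃ D : GL n R, formCongr σ D (Matrix.reindex e e
        (Matrix.fromBlocks (0 : Matrix (Fin r) (Fin r) R)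
          (Matrix.fromCols (0 : Matrix (Fin r) (Fin 1) R) (Matrix.of fun i j : Fin r => if i = Fin.rev j then (1 : R) else 0))
          (Matrix.fromRows (0 : Matrix (Fin 1) (Fin r) R) (Matrix.of fun i j : Fin r => if i = Fin.rev j then (1 : R) else 0))
          (Matrix.fromBlocks Han 0 0 (0 : Matrix (Fin r) (Fin r) R)))) =
      a • Matrix.reindex e e
        (Matrix.fromBlocks (0 : Matrix (Fin r) (Fin r) R)
          (Matrix.fromCols (0 : Matrix (Fin r) (Fin 1) R) (Matrix.of fun i j : Fin r => if i = Fin.rev j then (1 : R) else 0))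
          (Matrix.fromRows (0 : Matrix (Fin 1) (Fin r) R) (Matrix.of fun i j : Fin r => if i = Fin.rev j then (1 : R) else 0))
          (Matrix.fromBlocks (1 : Matrix (Fin 1) (Fin 1) R) 0 0 (0 : Matrix (Fin r) (Fin r) R))) := by
  classical
  obtain ⟨u, hu⟩ := ha
  -- the diagonal scaling, read through `e`: `1` on the `e`-block and the middle, `a` on the `f`-block
  let d : Fin r ⊕ (Fin 1 ⊕ Fin r) → Rˣ := Sum.elim (fun _ => 1) (Sum.elim (fun _ => 1) (fun _ => u))
  let dv : n → R := fun k => ((d (e.symm k) : Rˣ) : R)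
  let dinv : n → R := fun k => (((d (e.symm k))⁻¹ : Rˣ) : R)
  have h1 : Matrix.diagonal dv * Matrix.diagonal dinv = 1 := by
    rw [Matrix.diagonal_mul_diagonal, ← Matrix.diagonal_one]
    congr 1; funext k; simp [dv, dinv]
  have h2 : Matrix.diagonal dinv * Matrix.diagonal dv = 1 := by
    rw [Matrix.diagonal_mul_diagonal, ← Matrix.diagonal_one]
    congr 1; funext k; simp [dv, dinv]
  let D : GL n R := ⟨Matrix.diagonal dv, Matrix.diagonal dinv, h1, h2⟩
  refine ⟨D, ?_⟩
  have hD : (D : Matrix n n R) = Matrix.diagonal dv := rfl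
  have hσd : ∀ x : Fin r ⊕ (Fin 1 ⊕ Fin r), σ ((d x : Rˣ) : R) = ((d x : Rˣ) : R) := by
    rintro (x | x | x) <;> simp [d, hu, hσa]
  ext i j
  simp only [formCongr, hD, Matrix.diagonal_map (map_zero σ), Matrix.diagonal_transpose, Matrix.diagonal_mul, Matrix.mul_diagonal,
    Matrix.smul_apply, Matrix.reindex_apply, Matrix.submatrix_apply, smul_eq_mul, dv, hσd]
  generalize e.symm i = p
  generalize e.symm j = q
  rcases p with k | k | k <;> rcases q with l | l | l <;>
    simp [d, hu, Matrix.fromBlocks_apply₁₁, Matrix.fromBlocks_apply₁₂, Matrix.fromBlocks_apply₂₁, Matrix.fromBlocks_apply₂₂,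
      Matrix.fromCols_apply_inl, Matrix.fromCols_apply_inr, Matrix.fromRows_apply_inl, Matrix.fromRows_apply_inr,
      Fin.fin_one_eq_zero, hHan, mul_comm]

end Generic

/-! ## §2 Odd rank: any two non-degenerate hermitian forms have isomorphic local unitary groups -/

section CM

variable (L : Type) [Field L] [NumberField L] [IsCMField L] {N : ℕ}

/-- **Odd rank, non-split place: `U(H)(L⁺_v) ≃ₜ* U(H')(L⁺_v)`** for any two hermitian `H, H'` with unit determinant (both are the unitary group of
`a • W♭((N−1)∕2, (1))` over the field `E_v`). [cite: Jacobowitz1962, Thm. 3.1] [cite: PlatonovRapinchuk1994, §2.3] -/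
theorem nonempty_cmDatum_local_equiv_of_odd_of_smul_eq (hN : Odd N) {H H' : Matrix (Fin N) (Fin N) L}
    (hH : (H.map (cmConjRingHom L))ᵀ = H) (hHd : IsUnit H.det) (hH' : (H'.map (cmConjRingHom L))ᵀ = H') (hH'd : IsUnit H'.det)
    (v : HeightOneSpectrum (𝓞 ↥(maximalRealSubfield L))) (w : PlacesOver L v) (hw : IsCMField.complexConj L • w.1 = w.1) :
    Nonempty ((cmDatum L N H).Local v ≃ₜ* (cmDatum L N H').Local v) := by
  classical
  set c := IsCMField.complexConj L with hcdef
  have hc : c ≠ 1 := IsCMField.complexConj_ne_one L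
  obtain ⟨δ, hcδ, hδ⟩ := Literature.NumberTheory.Weil1982.UnitaryFinTopForm.exists_complexConj_eq_neg_ne_zero L
  have hE : IsField (LocalRing L v) := LocalRing.isField_of_smul_eq c hc w hw
  have hσ : ∀ x, conjLocal L c v (conjLocal L c v x) = x := Liu2021.LemD1OfPlace.conjLocal_conjLocal_apply L v c hcδ hδ
  have formCongr_smul : ∀ (T : GL (Fin N) (LocalRing L v)) (a : LocalRing L v) (J : Matrix (Fin N) (Fin N) (LocalRing L v)),
      formCongr (conjLocal L c v) T (a • J) = a • formCongr (conjLocal L c v) T J := fun T a J => by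
    simp only [formCongr, Matrix.mul_smul, Matrix.smul_mul]
  have hHc : (H.map c)ᵀ = H := by rw [hcdef, ← map_cmConjRingHom_eq_map_complexConj]; exact hH
  have hH'c : (H'.map c)ᵀ = H' := by rw [hcdef, ← map_cmConjRingHom_eq_map_complexConj]; exact hH'
  -- Witt normal forms of `H_v` and `H'_v`
  obtain ⟨r, m, e, T, Han, hrm, hm2, hHan, hanis, hT⟩ :=
    exists_GL_formCongr_eq_wittMatrix_rev_le_two L c v hcδ hδ hE N H hHc hHd.ne_zero
  obtain ⟨r', m', e', T', Han', hrm', hm2', hHan', hanis', hT'⟩ :=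
    exists_GL_formCongr_eq_wittMatrix_rev_le_two L c v hcδ hδ hE N H' hH'c hH'd.ne_zero
  rw [adelicForm_map_adeleToLocal] at hT hT'
  -- odd `N` forces `m = m' = 1` and `r = r'`
  obtain ⟨k, hk⟩ := hN
  obtain rfl : m = 1 := by omega
  obtain rfl : m' = 1 := by omega
  obtain rfl : r = r' := by omega
  -- the two scalars
  set a : LocalRing L v := Han 0 0 with hadef
  set a' : LocalRing L v := Han' 0 0 with ha'def
  have hσa : conjLocal L c v a = a := by
    have := congrFun (congrFun hHan 0) 0
    rwa [Matrix.transpose_apply, Matrix.map_apply] at this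
  have hσa' : conjLocal L c v a' = a' := by
    have := congrFun (congrFun hHan' 0) 0
    rwa [Matrix.transpose_apply, Matrix.map_apply] at this
  have hform1 : ∀ (G : Matrix (Fin 1) (Fin 1) (LocalRing L v)),
      hermForm (conjLocal L c v) G (Pi.single (0 : Fin 1) (1 : LocalRing L v)) (Pi.single (0 : Fin 1) (1 : LocalRing L v)) = G 0 0 := by
    intro G
    rw [hermForm_apply]
    simp [dotProduct, Matrix.mulVec, map_one]
  have ha : IsUnit a := by
    letI : Field (LocalRing L v) := hE.toField
    refine isUnit_iff_ne_zero.2 fun h0 => ?_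
    have := hanis (Pi.single (0 : Fin 1) (1 : LocalRing L v)) (by rw [hform1, ← hadef, h0])
    have h1 : (1 : LocalRing L v) = 0 := by simpa using congrFun this (0 : Fin 1)
    exact one_ne_zero h1
  have ha' : IsUnit a' := by
    letI : Field (LocalRing L v) := hE.toField
    refine isUnit_iff_ne_zero.2 fun h0 => ?_
    have := hanis' (Pi.single (0 : Fin 1) (1 : LocalRing L v)) (by rw [hform1, ← ha'def, h0])
    have h1 : (1 : LocalRing L v) = 0 := by simpa using congrFun this (0 : Fin 1)
    exact one_ne_zero h1
  -- scaling and permutation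
  obtain ⟨D, hD⟩ := exists_GL_formCongr_wittMatrix_one_eq_smul (conjLocal L c v) e a hσa ha Han rfl
  obtain ⟨D', hD'⟩ := exists_GL_formCongr_wittMatrix_one_eq_smul (conjLocal L c v) e' a' hσa' ha' Han' rfl
  set W1 := Matrix.fromBlocks (0 : Matrix (Fin r) (Fin r) (LocalRing L v))
      (Matrix.fromCols (0 : Matrix (Fin r) (Fin 1) (LocalRing L v)) (Matrix.of fun i j : Fin r => if i = Fin.rev j then (1 : LocalRing L v) else 0))
      (Matrix.fromRows (0 : Matrix (Fin 1) (Fin r) (LocalRing L v)) (Matrix.of fun i j : Fin r => if i = Fin.rev j then (1 : LocalRing L v) else 0))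
      (Matrix.fromBlocks (1 : Matrix (Fin 1) (Fin 1) (LocalRing L v)) 0 0 (0 : Matrix (Fin r) (Fin r) (LocalRing L v))) with hW1
  obtain ⟨P, hP⟩ := exists_GL_formCongr_reindex_eq_reindex (conjLocal L c v) e e' W1
  -- `Y := T D`: `ᵗσY H_v Y = a • R`;  `X := T' D' P`: `ᵗσX H'_v X = a' • R`, `R = reindex e e W1`
  have hY : formCongr (conjLocal L c v) (T * D) (H.map (algebraMap L (LocalRing L v))) = a • Matrix.reindex e e W1 := by
    rw [formCongr_mul, hT, hD]
  have hX : formCongr (conjLocal L c v) (T' * D' * P) (H'.map (algebraMap L (LocalRing L v))) = a' • Matrix.reindex e e W1 := by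
    rw [formCongr_mul, formCongr_mul, hT', hD', formCongr_smul, hP]
  -- combine: `ᵗσ(X Y⁻¹) H'_v (X Y⁻¹) = (a' a⁻¹) • H_v`
  obtain ⟨ua, hua⟩ := ha
  have hR : Matrix.reindex e e W1 = ((ua⁻¹ : (LocalRing L v)ˣ) : LocalRing L v) • formCongr (conjLocal L c v) (T * D) (H.map (algebraMap L (LocalRing L v))) := by
    rw [hY, ← hua, smul_smul, Units.inv_mul, one_smul]
  have hfinal : formCongr (conjLocal L c v) (T' * D' * P * (T * D)⁻¹) (H'.map (algebraMap L (LocalRing L v))) =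
      (a' * ((ua⁻¹ : (LocalRing L v)ˣ) : LocalRing L v)) • H.map (algebraMap L (LocalRing L v)) := by
    rw [formCongr_mul, hX, formCongr_smul, hR, formCongr_smul, formCongr_inv_formCongr, smul_smul]
  have hunit : IsUnit (a' * ((ua⁻¹ : (LocalRing L v)ˣ) : LocalRing L v)) := ha'.mul (Units.isUnit _)
  exact ⟨cmDatumLocalCongr L v (T' * D' * P * (T * D)⁻¹) hunit hfinal⟩

/-- **Odd rank: `U(H)(L⁺_v) ≃ₜ* U(H')(L⁺_v)` at EVERY finite place `v`** of `L⁺` (non-split: the previous theorem; split: ★ `cmDatumLocalSplitCongr`).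
[cite: Jacobowitz1962, Thm. 3.1] [cite: PlatonovRapinchuk1994, §2.3] -/
theorem nonempty_cmDatum_local_equiv_of_odd (hN : Odd N) {H H' : Matrix (Fin N) (Fin N) L}
    (hH : (H.map (cmConjRingHom L))ᵀ = H) (hHd : IsUnit H.det) (hH' : (H'.map (cmConjRingHom L))ᵀ = H') (hH'd : IsUnit H'.det)
    (v : HeightOneSpectrum (𝓞 ↥(maximalRealSubfield L))) :
    Nonempty ((cmDatum L N H).Local v ≃ₜ* (cmDatum L N H').Local v) :=
  nonempty_cmDatum_local_equiv_of_forall_nonsplit L hH hHd hH' hH'd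
    (fun v w hw => nonempty_cmDatum_local_equiv_of_odd_of_smul_eq L hN hH hHd hH' hH'd v w hw) v

/-- **Odd rank: every `U_N(H)` is locally the quasi-split `U(Φ_N)`** — `U(H)(L⁺_v) ≃ₜ* U(Φ_N)(L⁺_v)` at every finite place, `Φ_N = antidiag(1, …, 1)`
(written as the literal matrix of the `cmDatum` consumers, ★ `antidiagOne_eq_over`). [cite: Jacobowitz1962, Thm. 3.1] [cite: Rogawski1990, §14.2 p. 232] -/
theorem nonempty_cmDatum_local_equiv_antidiag_of_odd (hN : Odd N) (H : Matrix (Fin N) (Fin N) L)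
    (hH : (H.map (cmConjRingHom L))ᵀ = H) (hHd : IsUnit H.det) (v : HeightOneSpectrum (𝓞 ↥(maximalRealSubfield L))) :
    Nonempty ((cmDatum L N H).Local v ≃ₜ*
      (cmDatum L N (Matrix.of fun i j : Fin N => if i.val + j.val + 1 = N then (1 : L) else 0)).Local v) :=
  nonempty_cmDatum_local_equiv_of_odd L hN hH hHd (antidiagOne_isHermitian L N) (isUnit_antidiagOne_det L N) v

end CM

end Summit.HodgeConjecture.HodgeConjecture.Cruxes.H413.K2E3OddUnitaryLocalCongr

end
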